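import Literature.Probability.RandomPlanarGeometry.SAWPulledLargeForceExpansionZdFifthOrder
import Literature.Probability.RandomPlanarGeometry.SAWPulledLargeForceExpansionZdSevenStep
import Literature.Probability.RandomPlanarGeometry.SAWPulledLargeForceExpansionZdTwoSlackCount
import Literature.Probability.RandomPlanarGeometry.SAWPulledLargeForceExpansionZdStaples
import HarnessLib

/-!
# The pulled self-avoiding walk on `ℤ^{d+1}` at large force: the sixth coefficient `c^{(d)}_6 = −4d(8d⁴+52d³+26d²−18d+3)` in every dimension

Topic `Literature/Probability/RandomPlanarGeometry` (continues `SAWPulledLargeForceExpansionZdFifthOrder.lean` one order: the generic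
sixth-order algebra `coeff_pow_five`, `coeff_Pz_comp_five`, `a_six`, `e_six_eq`, and the cost-six data `N_{6,7}` (`…ZdSevenStep`:
`costCoeffZd_six_seven_add'`), `N_{6,8}` (`…ZdTwoSlackCount`: `TwoSlack.costCoeffZd_six_eight`), `N_{6,9}` (`…ZdStaples`:
`costCoeffZd_two_mul_three_mul` at `A = 3`), `N_{6,n} = 0` otherwise (`costCoeffZd_eq_zero_of_three_span`)).

Printed sources: E. J. Janse van Rensburg, S. G. Whittington, J. Phys. A 46 (2013) 435003, §3.2 Theorem 8 (the expansion to first order;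
the method); N. Madras, G. Slade, *The Self-Avoiding Walk* (1993), §1.2, §4.2. The coefficient `c_6` is not in print in any dimension
(lane «pcv-sawmu»; the `ℤ²` value `c_6 = −284` and the `d`-polynomial were conjectured from the lane's cost censuses, kit job j223029).

## Contents (all PROVED, standard axioms only; no data, no certificates)

* generic (`namespace CostSeries`): `pR c = Σ_n C(n,5) N_{c,n}`, `coeff_pow_five`, `coeff_Pz_comp_five`, ★ `a_six`, ★ `e_six_eq`;
* on `ℤ^{d+1}`: `costCoeffZd_six` (the whole cost-six column), the moments `pR_one = pQ_two = 0`, `pT_three`, `pH_four`, `pD_five`, `pS_six`,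
  `aZd_six = 64d⁶ + 480d⁵ + 880d⁴ + 240d³ − 76d² + 12d`, ★★ `largeForceCoeffZd_at_six : c^{(d)}_6 = −4d(8d⁴+52d³+26d²−18d+3)`
  (`d = 1, 2`: `−284`, `−4920`), `largeForceCoeff_six_eq : c_6(ℤ²) = −284`, ★ `exp_pulledBridgeFreeEnergy_sixth_order_zd`.

Provenance: lane «pcv-sawmu», a-p3 g17 (2026-08-25).
-/

noncomputable section

open Finset
open scoped BigOperators
open Literature.Probability.LatticeModels
open Literature.Probability.RandomPlanarGeometry.SAW

namespace Literature.Probability.RandomPlanarGeometry.SAW.Zd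

namespace CostSeries

variable (N : ℕ → ℕ → ℕ)

/-! ### Generic: fifth coefficients of powers and compositions, `a_6`, `e_6` -/

/-- `pR c = P_c⁽⁵⁾(1)/120 = Σ_n C(n,5) N_{c,n}`. [cite: JansevanRensburgWhittington2013, §3.2 Theorem 8 (arXiv v4 p. 11)] -/
def pR (c : ℕ) : ℤ := ∑ n ∈ Finset.range (2 * c + 2), (n.choose 5 : ℤ) * N c n

/-- The coefficient `5` of `p^n` when `p(0) = 1`:
`n p₅ + C(n,2)(2 p₁p₄ + 2 p₂p₃) + C(n,3)(3 p₁²p₃ + 3 p₁p₂²) + 4 C(n,4) p₁³p₂ + C(n,5) p₁⁵`.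
[cite: JansevanRensburgWhittington2013, §3.2 Theorem 8 (arXiv v4 p. 11)] -/
theorem coeff_pow_five (p : Polynomial ℤ) (h0 : p.coeff 0 = 1) (n : ℕ) :
    (p ^ n).coeff 5 = n * p.coeff 5 + (n.choose 2 : ℤ) * (2 * (p.coeff 1 * p.coeff 4) + 2 * (p.coeff 2 * p.coeff 3)) +
      (n.choose 3 : ℤ) * (3 * (p.coeff 1 ^ 2 * p.coeff 3) + 3 * (p.coeff 1 * p.coeff 2 ^ 2)) +
      4 * (n.choose 4 : ℤ) * (p.coeff 1 ^ 3 * p.coeff 2) + (n.choose 5 : ℤ) * p.coeff 1 ^ 5 := by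
  induction n with
  | zero => simp [Polynomial.coeff_one]
  | succ n ih =>
    obtain ⟨i0, i1, i2⟩ := coeff_pow_low p h0 n
    have i3 := coeff_pow_three p h0 n
    have i4 := coeff_pow_four p h0 n
    rw [pow_succ, Polynomial.coeff_mul, Finset.Nat.sum_antidiagonal_eq_sum_range_succ_mk]
    simp only [Finset.sum_range_succ, Finset.sum_range_zero, Nat.reduceSub, Nat.sub_self, zero_add]
    rw [i0, i1, i2, i3, i4, ih, h0, Nat.choose_succ_succ n 1, Nat.choose_succ_succ n 2, Nat.choose_succ_succ n 3,
      Nat.choose_succ_succ n 4, Nat.choose_one_right]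
    push_cast; ring

/-- `[X⁵](P_c ∘ q) = pD q₅ + pH (2 q₁q₄ + 2 q₂q₃) + pT (3 q₁²q₃ + 3 q₁q₂²) + 4 pQ q₁³q₂ + pR q₁⁵` for `q(0) = 1`.
[cite: JansevanRensburgWhittington2013, §3.2 Theorem 8 (arXiv v4 p. 11)] -/
theorem coeff_Pz_comp_five (c : ℕ) (q : Polynomial ℤ) (h0 : q.coeff 0 = 1) :
    ((Pz N c).comp q).coeff 5 = pD N c * q.coeff 5 + pH N c * (2 * (q.coeff 1 * q.coeff 4) + 2 * (q.coeff 2 * q.coeff 3)) +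
      pT N c * (3 * (q.coeff 1 ^ 2 * q.coeff 3) + 3 * (q.coeff 1 * q.coeff 2 ^ 2)) + 4 * pQ N c * (q.coeff 1 ^ 3 * q.coeff 2) +
      pR N c * q.coeff 1 ^ 5 := by
  have hQ : 4 * pQ N c * (q.coeff 1 ^ 3 * q.coeff 2) =
      ∑ n ∈ Finset.range (2 * c + 2), 4 * (n.choose 4 : ℤ) * N c n * (q.coeff 1 ^ 3 * q.coeff 2) := by
    rw [pQ, Finset.mul_sum, Finset.sum_mul]
    refine Finset.sum_congr rfl fun n _ => ?_
    ring
  rw [Pz_comp_eq, Polynomial.finsetSum_coeff, pD, pH, pT, pR, hQ, Finset.sum_mul, Finset.sum_mul, Finset.sum_mul, Finset.sum_mul,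
    ← Finset.sum_add_distrib, ← Finset.sum_add_distrib, ← Finset.sum_add_distrib, ← Finset.sum_add_distrib]
  refine Finset.sum_congr rfl fun n _ => ?_
  rw [Polynomial.coeff_C_mul, coeff_pow_five q h0 n]
  ring

/-- ★ `a_6 = −([X⁵](P₁∘A₅) + [X⁴](P₂∘A₅) + [X³](P₃∘A₅) + [X²](P₄∘A₅) + [X¹](P₅∘A₅) + pS₆)` in the moments.
[cite: JansevanRensburgWhittington2013, §3.2 Theorem 8 (arXiv v4 p. 11)] -/
theorem a_six : a N 6 =
    -((pD N 1 * a N 5 + pH N 1 * (2 * (a N 1 * a N 4) + 2 * (a N 2 * a N 3)) +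
        pT N 1 * (3 * (a N 1 ^ 2 * a N 3) + 3 * (a N 1 * a N 2 ^ 2)) + 4 * pQ N 1 * (a N 1 ^ 3 * a N 2) + pR N 1 * a N 1 ^ 5)
      + (pD N 2 * a N 4 + pH N 2 * (2 * (a N 1 * a N 3) + a N 2 ^ 2) + 3 * pT N 2 * (a N 1 ^ 2 * a N 2) + pQ N 2 * a N 1 ^ 4)
      + (pD N 3 * a N 3 + 2 * pH N 3 * (a N 1 * a N 2) + pT N 3 * a N 1 ^ 3) + (pD N 4 * a N 2 + pH N 4 * a N 1 ^ 2)
      + pD N 5 * a N 1 + pS N 6) := by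
  have h0 : (A N 5).coeff 0 = 1 := coeff_A_zero_eq_one N 5
  rw [a_succ]
  simp only [Finset.sum_range_succ, Finset.sum_range_zero, Nat.reduceAdd, Nat.reduceSub, Nat.sub_self, zero_add]
  rw [coeff_Pz_comp_five N 1 _ h0, coeff_Pz_comp_four N 2 _ h0, coeff_Pz_comp_three N 3 _ h0, coeff_Pz_comp_two N 4 _ h0,
    coeff_Pz_comp_one N 5 _ h0, coeff_Pz_comp_zero N 6 _ h0, coeff_A_eq_a N (show 5 ≤ 5 from le_rfl),
    coeff_A_eq_a N (show 4 ≤ 5 by norm_num), coeff_A_eq_a N (show 3 ≤ 5 by norm_num), coeff_A_eq_a N (show 2 ≤ 5 by norm_num),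
    coeff_A_eq_a N (show 1 ≤ 5 by norm_num)]

/-- ★ `e_6 = −(a_1 e_5 + a_2 e_4 + a_3 e_3 + a_4 e_2 + a_5 e_1 + a_6)`. [cite: JansevanRensburgWhittington2013, §3.2 Theorem 8 (arXiv v4 p. 11)] -/
theorem e_six_eq : e N 6 = -(a N 1 * e N 5 + a N 2 * e N 4 + a N 3 * e N 3 + a N 4 * e N 2 + a N 5 * e N 1 + a N 6) := by
  have h := sum_antidiagonal_a_mul_e N (k := 6) (by norm_num)
  rw [Finset.Nat.sum_antidiagonal_eq_sum_range_succ_mk] at h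
  simp only [Finset.sum_range_succ, Finset.sum_range_zero, Nat.reduceSub, Nat.sub_self, a_zero, e_zero, zero_add, one_mul,
    mul_one] at h
  linear_combination h

end CostSeries

/-! ### The cost-six column on `ℤ^{d+1}` -/

/-- `N_{6,8} + 216d³ = 160d⁴ + 56d² + 24d` (subtraction-free form of `TwoSlack.costCoeffZd_six_eight`). [cite: MadrasSlade1993, §4.2] -/
theorem costCoeffZd_six_eight_add (d : ℕ) : costCoeffZd d 6 8 + 216 * d ^ 3 = 160 * d ^ 4 + 56 * d ^ 2 + 24 * d := by
  have h := TwoSlack.costCoeffZd_six_eight d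
  have hle : 216 * d ^ 3 ≤ 160 * d ^ 4 + 56 * d ^ 2 + 24 * d := by
    rcases Nat.lt_or_ge d 2 with hd | hd
    · interval_cases d <;> norm_num
    · calc 216 * d ^ 3 ≤ 320 * d ^ 3 := Nat.mul_le_mul_right _ (by norm_num)
        _ = 160 * d ^ 3 * 2 := by ring
        _ ≤ 160 * d ^ 3 * d := Nat.mul_le_mul_left _ hd
        _ = 160 * d ^ 4 := by ring
        _ ≤ 160 * d ^ 4 + 56 * d ^ 2 + 24 * d := by omega
  omega

/-- `N_{6,9} = 2d(2d−1)` (the staples of span three). [cite: MadrasSlade1993, §4.2, eq. (4.2.20)–(4.2.22) (p. 94, 2013 reprint)] -/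
theorem costCoeffZd_six_nine (d : ℕ) : costCoeffZd d 6 9 = 2 * d * (2 * d - 1) := by
  simpa using costCoeffZd_two_mul_three_mul d 3 (by norm_num)

/-- ★ **`N_{6,n}`** on `ℤ^{d+1}`: the six-step self-avoiding walks of `ℤ^d` at `n = 7`, `160d⁴ − 216d³ + 56d² + 24d` at `n = 8`, the staples
`2d(2d−1)` at `n = 9`, zero otherwise. [cite: MadrasSlade1993, §4.2, eq. (4.2.20)–(4.2.22) (p. 94, 2013 reprint)] -/
theorem costCoeffZd_six (d n : ℕ) : costCoeffZd d 6 n =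
    if n = 7 then 64 * d ^ 6 + 112 * d ^ 4 + 20 * d ^ 2 - 160 * d ^ 5 - 34 * d
    else if n = 8 then 160 * d ^ 4 + 56 * d ^ 2 + 24 * d - 216 * d ^ 3 else if n = 9 then 2 * d * (2 * d - 1) else 0 := by
  by_cases h7 : n = 7
  · subst h7; rw [if_pos rfl, costCoeffZd_six_seven]
  rw [if_neg h7]
  by_cases h8 : n = 8
  · subst h8; rw [if_pos rfl, TwoSlack.costCoeffZd_six_eight]
  rw [if_neg h8]
  by_cases h9 : n = 9
  · subst h9; rw [if_pos rfl, costCoeffZd_six_nine]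
  rw [if_neg h9]
  rcases Nat.lt_or_ge n 7 with h | h
  · exact costCoeffZd_eq_zero_of_le (by omega)
  · exact costCoeffZd_eq_zero_of_three_span (by omega) (by omega)

/-! ### The moments of the cost data up to cost six and `c^{(d)}_6` -/

/-- `pR₁ = 0`. [cite: JansevanRensburgWhittington2013, §3.2 Theorem 8 (arXiv v4 p. 11)] -/
theorem pR_one (d : ℕ) : CostSeries.pR (costCoeffZd d) 1 = 0 := by
  rw [CostSeries.pR, show 2 * 1 + 2 = 4 from rfl]
  simp only [Finset.sum_range_succ, Finset.sum_range_zero, costCoeffZd_one_two,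
    costCoeffZd_one_of_ne_two d (show (0:ℕ) ≠ 2 by norm_num), costCoeffZd_one_of_ne_two d (show (1:ℕ) ≠ 2 by norm_num),
    costCoeffZd_one_of_ne_two d (show (3:ℕ) ≠ 2 by norm_num), Nat.choose]
  push_cast; ring

/-- `pQ₂ = 0`. [cite: JansevanRensburgWhittington2013, §3.2 Theorem 8 (arXiv v4 p. 11)] -/
theorem pQ_two (d : ℕ) : CostSeries.pQ (costCoeffZd d) 2 = 0 := by
  rw [CostSeries.pQ, show 2 * 2 + 2 = 6 from rfl]
  simp only [Finset.sum_range_succ, Finset.sum_range_zero, costCoeffZd_two, Nat.choose]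
  simp

/-- `pT₃ = 4 N_{3,4} = 32d³ − 32d² + 8d`. [cite: JansevanRensburgWhittington2013, §3.2 Theorem 8 (arXiv v4 p. 11)] -/
theorem pT_three (d : ℕ) : CostSeries.pT (costCoeffZd d) 3 = 32 * d ^ 3 - 32 * d ^ 2 + 8 * d := by
  rw [CostSeries.pT, show 2 * 3 + 2 = 8 from rfl]
  simp only [Finset.sum_range_succ, Finset.sum_range_zero, costCoeffZd_three, Nat.choose]
  rcases Nat.eq_zero_or_pos d with rfl | hd
  · simp
  · obtain ⟨e, rfl⟩ : ∃ e, d = e + 1 := ⟨d - 1, by omega⟩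
    simp only [show 2 * (e + 1) - 1 = 2 * e + 1 by omega]
    push_cast; ring

/-- `pH₄ = 10 N_{4,5} + 15 N_{4,6} = 160d⁴ − 240d³ + 140d² − 10d`. [cite: JansevanRensburgWhittington2013, §3.2 Theorem 8 (arXiv v4 p. 11)] -/
theorem pH_four (d : ℕ) : CostSeries.pH (costCoeffZd d) 4 = 160 * d ^ 4 - 240 * d ^ 3 + 140 * d ^ 2 - 10 * d := by
  have h45 := costCoeffZd_four_five_add d
  rw [CostSeries.pH, show 2 * 4 + 2 = 10 from rfl]
  simp only [Finset.sum_range_succ, Finset.sum_range_zero, costCoeffZd_four_six, costCoeffZd_four_seven,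
    costCoeffZd_eq_zero_of_le (show 0 ≤ 4 by norm_num), costCoeffZd_eq_zero_of_le (show 1 ≤ 4 by norm_num),
    costCoeffZd_eq_zero_of_le (show 2 ≤ 4 by norm_num), costCoeffZd_eq_zero_of_le (show 3 ≤ 4 by norm_num),
    costCoeffZd_eq_zero_of_le (show 4 ≤ 4 from le_rfl),
    costCoeffZd_eq_zero_of_lt (show 3 * 4 + 2 < 2 * 8 by norm_num), costCoeffZd_eq_zero_of_lt (show 3 * 4 + 2 < 2 * 9 by norm_num),
    Nat.choose]
  rcases Nat.eq_zero_or_pos d with rfl | hd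
  · simp at h45 ⊢
    have : costCoeffZd 0 4 5 = 0 := by simpa using h45
    simp [this]
  · obtain ⟨e, rfl⟩ : ∃ e, d = e + 1 := ⟨d - 1, by omega⟩
    simp only [show 2 * (e + 1) - 1 = 2 * e + 1 by omega, show 2 * (e + 1) - 2 = 2 * e by omega] at h45 ⊢
    have h45' : (costCoeffZd (e + 1) 4 5 : ℤ) = 2 * (e + 1) * (2 * e + 1) ^ 3 - 2 * (e + 1) * (2 * e) := by
      have := congrArg (fun m : ℕ => (m : ℤ)) h45
      push_cast at this
      linarith
    push_cast
    rw [h45']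
    ring

/-- `pD₅ = 6 N_{5,6} + 7 N_{5,7} = 192d⁵ − 384d⁴ + 416d³ − 152d² − 4d`. [cite: JansevanRensburgWhittington2013, §3.2 Theorem 8 (arXiv v4 p. 11)] -/
theorem pD_five (d : ℕ) : CostSeries.pD (costCoeffZd d) 5 = 192 * d ^ 5 - 384 * d ^ 4 + 416 * d ^ 3 - 152 * d ^ 2 - 4 * d := by
  have h56 := costCoeffZd_five_six_add d
  rw [CostSeries.pD, show 2 * 5 + 2 = 12 from rfl]
  simp only [Finset.sum_range_succ, Finset.sum_range_zero, costCoeffZd_five_seven,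
    costCoeffZd_eq_zero_of_le (show 0 ≤ 5 by norm_num), costCoeffZd_eq_zero_of_le (show 1 ≤ 5 by norm_num),
    costCoeffZd_eq_zero_of_le (show 2 ≤ 5 by norm_num), costCoeffZd_eq_zero_of_le (show 3 ≤ 5 by norm_num),
    costCoeffZd_eq_zero_of_le (show 4 ≤ 5 by norm_num), costCoeffZd_eq_zero_of_le (show 5 ≤ 5 from le_rfl),
    costCoeffZd_eq_zero_of_three_span (show 5 + 2 ≤ 8 by norm_num) (show 3 * 5 < 2 * 8 by norm_num),
    costCoeffZd_eq_zero_of_three_span (show 5 + 2 ≤ 9 by norm_num) (show 3 * 5 < 2 * 9 by norm_num),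
    costCoeffZd_eq_zero_of_three_span (show 5 + 2 ≤ 10 by norm_num) (show 3 * 5 < 2 * 10 by norm_num),
    costCoeffZd_eq_zero_of_three_span (show 5 + 2 ≤ 11 by norm_num) (show 3 * 5 < 2 * 11 by norm_num)]
  rcases Nat.eq_zero_or_pos d with rfl | hd
  · simp at h56 ⊢
    have : costCoeffZd 0 5 6 = 0 := by simpa using h56
    simp [this]
  · obtain ⟨e, rfl⟩ : ∃ e, d = e + 1 := ⟨d - 1, by omega⟩
    simp only [show 2 * (e + 1) - 1 = 2 * e + 1 by omega, show 2 * (e + 1) - 2 = 2 * e by omega,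
      show 4 * (e + 1) - 3 = 4 * e + 1 by omega] at h56 ⊢
    have h56' : (costCoeffZd (e + 1) 5 6 : ℤ) = 2 * (e + 1) * (2 * e + 1) ^ 4 - 2 * (e + 1) * (2 * e) * (4 * e + 1) := by
      have := congrArg (fun m : ℕ => (m : ℤ)) h56
      push_cast at this
      linarith
    push_cast
    rw [h56']
    ring

/-- ★ `pS₆ = N_{6,7} + N_{6,8} + N_{6,9} = 64d⁶ − 160d⁵ + 272d⁴ − 216d³ + 80d² − 12d`.
[cite: JansevanRensburgWhittington2013, §3.2 Theorem 8 (arXiv v4 p. 11)] -/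
theorem pS_six (d : ℕ) : CostSeries.pS (costCoeffZd d) 6 = 64 * d ^ 6 - 160 * d ^ 5 + 272 * d ^ 4 - 216 * d ^ 3 + 80 * d ^ 2 - 12 * d := by
  have h67 := costCoeffZd_six_seven_add' d
  have h68 := costCoeffZd_six_eight_add d
  have h69 := costCoeffZd_six_nine d
  rw [CostSeries.pS, show 2 * 6 + 2 = 14 from rfl]
  simp only [Finset.sum_range_succ, Finset.sum_range_zero,
    costCoeffZd_eq_zero_of_le (show 0 ≤ 6 by norm_num), costCoeffZd_eq_zero_of_le (show 1 ≤ 6 by norm_num),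
    costCoeffZd_eq_zero_of_le (show 2 ≤ 6 by norm_num), costCoeffZd_eq_zero_of_le (show 3 ≤ 6 by norm_num),
    costCoeffZd_eq_zero_of_le (show 4 ≤ 6 by norm_num), costCoeffZd_eq_zero_of_le (show 5 ≤ 6 by norm_num),
    costCoeffZd_eq_zero_of_le (show 6 ≤ 6 from le_rfl),
    costCoeffZd_eq_zero_of_three_span (show 6 + 2 ≤ 10 by norm_num) (show 3 * 6 < 2 * 10 by norm_num),
    costCoeffZd_eq_zero_of_three_span (show 6 + 2 ≤ 11 by norm_num) (show 3 * 6 < 2 * 11 by norm_num),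
    costCoeffZd_eq_zero_of_three_span (show 6 + 2 ≤ 12 by norm_num) (show 3 * 6 < 2 * 12 by norm_num),
    costCoeffZd_eq_zero_of_three_span (show 6 + 2 ≤ 13 by norm_num) (show 3 * 6 < 2 * 13 by norm_num)]
  have h67' : (costCoeffZd d 6 7 : ℤ) = 64 * d ^ 6 + 112 * d ^ 4 + 20 * d ^ 2 - 160 * d ^ 5 - 34 * d := by
    have := congrArg (fun m : ℕ => (m : ℤ)) h67
    push_cast at this
    linarith
  have h68' : (costCoeffZd d 6 8 : ℤ) = 160 * d ^ 4 + 56 * d ^ 2 + 24 * d - 216 * d ^ 3 := by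
    have := congrArg (fun m : ℕ => (m : ℤ)) h68
    push_cast at this
    linarith
  rcases Nat.eq_zero_or_pos d with rfl | hd
  · have h69z : (costCoeffZd 0 6 9 : ℤ) = 0 := by rw [h69]; simp
    norm_num at h67' h68' ⊢
    linarith
  · obtain ⟨e, rfl⟩ : ∃ e, d = e + 1 := ⟨d - 1, by omega⟩
    simp only [show 2 * (e + 1) - 1 = 2 * e + 1 by omega] at h69
    push_cast at h67' h68' ⊢
    rw [h67', h68', h69]
    push_cast
    ring

/-- `a₆ = 64d⁶ + 480d⁵ + 880d⁴ + 240d³ − 76d² + 12d` on `ℤ^{d+1}`. [cite: JansevanRensburgWhittington2013, §3.2 Theorem 8 (arXiv v4 p. 11)] -/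
theorem aZd_six (d : ℕ) :
    CostSeries.a (costCoeffZd d) 6 = 64 * d ^ 6 + 480 * d ^ 5 + 880 * d ^ 4 + 240 * d ^ 3 - 76 * d ^ 2 + 12 * d := by
  rw [CostSeries.a_six, aZd_one, aZd_two, aZd_three, aZd_four, aZd_five, pD_one, pH_one, pT_one, pQ_one, pR_one, pD_two, pH_two,
    pT_two, pQ_two, pD_three, pH_three, pT_three, pD_four, pH_four, pD_five, pS_six]
  push_cast; ring

/-- ★★ **THE SIXTH COEFFICIENT: `c^{(d)}_6 = −4d(8d⁴ + 52d³ + 26d² − 18d + 3)`** on `ℤ^{d+1}`, every dimension (`d = 1, 2`: `−284`, `−4920`).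
[cite: JansevanRensburgWhittington2013, §3.2 Theorem 8 (arXiv v4 p. 11)] -/
theorem largeForceCoeffZd_at_six (d : ℕ) :
    largeForceCoeffZd d 6 = -(4 * d * (8 * d ^ 4 + 52 * d ^ 3 + 26 * d ^ 2 - 18 * d + 3)) := by
  have e1 : CostSeries.e (costCoeffZd d) 1 = 2 * d := largeForceCoeffZd_at_one d
  have e2 : CostSeries.e (costCoeffZd d) 2 = -(2 * (d : ℤ)) := largeForceCoeffZd_at_two d
  have e3 : CostSeries.e (costCoeffZd d) 3 = 2 * d * (2 * d + 1) := largeForceCoeffZd_at_three d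
  have e4 : CostSeries.e (costCoeffZd d) 4 = -(4 * (d : ℤ) ^ 2 * (2 * d + 3)) := largeForceCoeffZd_at_four d
  have e5 : CostSeries.e (costCoeffZd d) 5 = 2 * d * (8 * d ^ 3 + 28 * d ^ 2 + 2 * d - 1) := largeForceCoeffZd_at_five d
  show CostSeries.e (costCoeffZd d) 6 = _
  rw [CostSeries.e_six_eq, aZd_one, aZd_two, aZd_three, aZd_four, aZd_five, aZd_six, e1, e2, e3, e4, e5]
  ring

/-- `c_6 = −284` on `ℤ²` (the lane's conjectured value, now a theorem without certificates; numerically `−c_6 = 284 = c_5(ℤ²)`, a coincidence).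
[cite: JansevanRensburgWhittington2013, §3.2 Theorem 8 (arXiv v4 p. 11)] -/
theorem largeForceCoeff_six_eq : largeForceCoeff 6 = -284 := by
  rw [← largeForceCoeffZd_one 6, largeForceCoeffZd_at_six]; norm_num

/-- ★★ **`e^{λ_B(y)} = y + 2d − 2d/y + 2d(2d+1)/y² − 4d²(2d+3)/y³ + 2d(8d³+28d²+2d−1)/y⁴ − 4d(8d⁴+52d³+26d²−18d+3)/y⁵ + O(1/y⁶)`
on `ℤ^{d+1}`, every dimension.** [cite: JansevanRensburgWhittington2013, §3.2 Theorem 8 (arXiv v4 p. 11)] -/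
theorem exp_pulledBridgeFreeEnergy_sixth_order_zd (d : ℕ) :
    ∃ C y₁ : ℝ, 0 < y₁ ∧ ∀ y ≥ y₁,
      |Real.exp (pulledBridgeFreeEnergy (d + 1) y) -
        (y + 2 * d - 2 * d / y + 2 * d * (2 * d + 1) / y ^ 2 - 4 * d ^ 2 * (2 * d + 3) / y ^ 3 +
          2 * d * (8 * d ^ 3 + 28 * d ^ 2 + 2 * d - 1) / y ^ 4 - 4 * d * (8 * d ^ 4 + 52 * d ^ 3 + 26 * d ^ 2 - 18 * d + 3) / y ^ 5)| ≤
        C / y ^ 6 := by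
  obtain ⟨C, y₁, hy₁, h⟩ := exp_pulledBridgeFreeEnergy_expansion_zd d 6
  refine ⟨C, y₁, hy₁, fun y hy => ?_⟩
  have hy0 : 0 < y := lt_of_lt_of_le hy₁ hy
  have h1 := h y hy
  have hs : ∑ k ∈ Finset.range (6 + 1), y * ((largeForceCoeffZd d k : ℝ) * y⁻¹ ^ k) =
      y + 2 * d - 2 * d / y + 2 * d * (2 * d + 1) / y ^ 2 - 4 * d ^ 2 * (2 * d + 3) / y ^ 3 +
        2 * d * (8 * d ^ 3 + 28 * d ^ 2 + 2 * d - 1) / y ^ 4 - 4 * d * (8 * d ^ 4 + 52 * d ^ 3 + 26 * d ^ 2 - 18 * d + 3) / y ^ 5 := by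
    rw [Finset.sum_range_succ, Finset.sum_range_succ, Finset.sum_range_succ, Finset.sum_range_succ, Finset.sum_range_succ,
      Finset.sum_range_succ, Finset.sum_range_one, largeForceCoeffZd_zero, largeForceCoeffZd_at_one, largeForceCoeffZd_at_two,
      largeForceCoeffZd_at_three, largeForceCoeffZd_at_four, largeForceCoeffZd_at_five, largeForceCoeffZd_at_six]
    push_cast
    field_simp
    ring
  rwa [hs] at h1

end Literature.Probability.RandomPlanarGeometry.SAW.Zd

end
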